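import Literature.AnabelianGeometry.SemiGraphs.ProSigmaPuncturedSlim
import Literature.AnabelianGeometry.SemiGraphs.ProSigmaCompletionModels
import HarnessLib

/-!
# The profinite completion of a nonabelian free group is slim

Topic `Literature/GroupTheory` — step (3δ) of the abc-iut cell's campaign-L R1 (topological Galois
correspondence → id-rigidity of categories of finite covers; GAP row G-L4t14-R1, requested shape of
abc-iut-w5-d144): for a group `G` isomorphic to a free group `FreeGroup (Fin n)` with `n ≥ 2`, the
profinite completion `Ĝ` (the tree's `Literature.IUT.HodgeTheaters.profiniteCompletion G` =
Mathlib's `ProfiniteGrp.ProfiniteCompletion`) is SLIM (`IsSlimGroup`: every open subgroup has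
trivial centraliser).

This is a junction file, assembling by name:
* `SemiGraphOfAnabelioids.isSlimGroup_of_isProSigmaCompletion` (`ProSigmaPuncturedSlim.lean`;
  [AbsAnab] Lemma 1.3.1: pro-`Σ` completions of nonabelian free groups are slim), and
* `SemiGraphOfAnabelioids.IsProSigmaCompletion.isProSigmaCompletion_toCompletion`
  (`ProSigmaCompletionModels.lean`: Mathlib's `η : G → Ĝ` is a pro-`Σ` completion for
  `Σ = {all primes}`),
with two elementary transports: non-commutativity along a group isomorphism, and the
non-commutativity of `FreeGroup ι` as soon as `ι` has two distinct letters (checked in `S₃`, as in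
`PuncturedSurfaceGroup.exists_mul_ne_mul`).

Main statements: `FreeGroup.exists_mul_ne_mul_of_ne`, `isSlimGroup_profiniteCompletion_of_isFreeGroup`,
`isSlimGroup_profiniteCompletion_freeGroup`, `isSlimGroup_profiniteCompletion_of_mulEquiv_freeGroup`.
Proof-only: no definitions, no named facts.

## References
* S. Mochizuki, *The absolute anabelian geometry of hyperbolic curves* (2004), Lemma 1.3.1.
  [MochizukiAbsAnab2004]
* R. C. Lyndon, P. E. Schupp, *Combinatorial Group Theory*, Springer 2001, Ch. I Prop. 2.16 ff.
  (centralisers in free groups). [LyndonSchupp2001]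
-/

noncomputable section

namespace Literature.GroupTheory

open Literature.AlgebraicGeometry.Frobenioids (IsSlimGroup)
open Literature.IUT.HodgeTheaters (profiniteCompletion toCompletion)
open Literature.AnabelianGeometry.SemiGraphs

universe u v

/-! ### §1 Elementary transports -/

/-- Non-commutativity transports along a group isomorphism (trivial bookkeeping).
[cite: LyndonSchupp2001, Ch. I §1] -/
theorem exists_mul_ne_mul_of_mulEquiv {G : Type u} {H : Type v} [Group G] [Group H] (e : G ≃* H)
    (h : ∃ x y : H, x * y ≠ y * x) : ∃ x y : G, x * y ≠ y * x := by
  obtain ⟨x, y, hxy⟩ := h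
  refine ⟨e.symm x, e.symm y, fun heq ↦ hxy ?_⟩
  simpa using congrArg e heq

/-- **Two distinct free generators do not commute**: in `FreeGroup ι`, `of a * of b ≠ of b * of a`
for `a ≠ b` (send `a ↦ (0 1)`, `b ↦ (1 2)` in `S₃`). [cite: LyndonSchupp2001, Ch. I Prop. 2.16] -/
theorem FreeGroup.of_mul_of_ne_of_mul_of {ι : Type u} {a b : ι} (hab : a ≠ b) :
    FreeGroup.of a * FreeGroup.of b ≠ FreeGroup.of b * FreeGroup.of a := by
  classical
  intro heq
  let s : ι → Equiv.Perm (Fin 3) := fun w ↦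
    if w = a then Equiv.swap 0 1 else if w = b then Equiv.swap 1 2 else 1
  have hsa : s a = Equiv.swap 0 1 := by simp [s]
  have hsb : s b = Equiv.swap 1 2 := by simp [s, Ne.symm hab]
  have h3 := congrArg (FreeGroup.lift s) heq
  rw [map_mul, map_mul, FreeGroup.lift_apply_of, FreeGroup.lift_apply_of, hsa, hsb] at h3
  exact absurd h3 (by decide)

/-- A free group on at least two letters is nonabelian. [cite: LyndonSchupp2001, Ch. I Prop. 2.16] -/
theorem FreeGroup.exists_mul_ne_mul_of_ne {ι : Type u} {a b : ι} (hab : a ≠ b) :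
    ∃ x y : FreeGroup ι, x * y ≠ y * x :=
  ⟨FreeGroup.of a, FreeGroup.of b, FreeGroup.of_mul_of_ne_of_mul_of hab⟩

/-- `FreeGroup (Fin n)` is nonabelian for `2 ≤ n`. [cite: LyndonSchupp2001, Ch. I Prop. 2.16] -/
theorem FreeGroup.exists_mul_ne_mul_fin {n : ℕ} (hn : 2 ≤ n) :
    ∃ x y : FreeGroup (Fin n), x * y ≠ y * x :=
  FreeGroup.exists_mul_ne_mul_of_ne (a := (⟨0, by omega⟩ : Fin n)) (b := ⟨1, by omega⟩)
    (by simp [Fin.ext_iff])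

/-! ### §2 Slimness of the profinite completion -/

/-- **The profinite completion of a nonabelian free group is slim** ([AbsAnab] Lemma 1.3.1 for
`Σ = {all primes}`): for `G` free (`IsFreeGroup`, any rank) and nonabelian, every open subgroup of
`Ĝ = profiniteCompletion G` has trivial centraliser.  Assembly of the tree's pro-`Σ` slimness
theorem with the fact that Mathlib's profinite completion is a pro-`{all primes}` completion.
[cite: MochizukiAbsAnab2004, Lemma 1.3.1 p.15] -/
theorem isSlimGroup_profiniteCompletion_of_isFreeGroup {G : Type u} [Group G] [IsFreeGroup G]
    (hG : ∃ x y : G, x * y ≠ y * x) : IsSlimGroup (profiniteCompletion G) :=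
  SemiGraphOfAnabelioids.isSlimGroup_of_isProSigmaCompletion hG (toCompletion G)
    (SemiGraphOfAnabelioids.IsProSigmaCompletion.isProSigmaCompletion_toCompletion G)

/-- The profinite completion of `FreeGroup ι` is slim as soon as `ι` has two distinct letters.
[cite: MochizukiAbsAnab2004, Lemma 1.3.1 p.15] -/
theorem isSlimGroup_profiniteCompletion_freeGroup_of_ne {ι : Type u} {a b : ι} (hab : a ≠ b) :
    IsSlimGroup (profiniteCompletion (FreeGroup ι)) :=
  isSlimGroup_profiniteCompletion_of_isFreeGroup (FreeGroup.exists_mul_ne_mul_of_ne hab)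

/-- The profinite completion of the free group `F_n = FreeGroup (Fin n)`, `n ≥ 2`, is slim.
[cite: MochizukiAbsAnab2004, Lemma 1.3.1 p.15] -/
theorem isSlimGroup_profiniteCompletion_freeGroup {n : ℕ} (hn : 2 ≤ n) :
    IsSlimGroup (profiniteCompletion (FreeGroup (Fin n))) :=
  isSlimGroup_profiniteCompletion_of_isFreeGroup (FreeGroup.exists_mul_ne_mul_fin hn)

/-- **Requested shape (abc-iut-w5-d144, R1 step 3δ)**: for a group `G` isomorphic to
`FreeGroup (Fin n)` with `2 ≤ n` — e.g. `π₁` of the plane punctured at `n ≥ 2` points — the profinite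
completion `Ĝ` is slim. [cite: MochizukiAbsAnab2004, Lemma 1.3.1 p.15] -/
theorem isSlimGroup_profiniteCompletion_of_mulEquiv_freeGroup {G : Type u} [Group G] {n : ℕ}
    (e : G ≃* FreeGroup (Fin n)) (hn : 2 ≤ n) : IsSlimGroup (profiniteCompletion G) :=
  haveI : IsFreeGroup G := IsFreeGroup.ofMulEquiv e.symm
  isSlimGroup_profiniteCompletion_of_isFreeGroup
    (exists_mul_ne_mul_of_mulEquiv e (FreeGroup.exists_mul_ne_mul_fin hn))

/-- The same for an isomorphism with a free group on any index type with two distinct letters.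
[cite: MochizukiAbsAnab2004, Lemma 1.3.1 p.15] -/
theorem isSlimGroup_profiniteCompletion_of_mulEquiv_freeGroup_of_ne {G : Type u} [Group G]
    {ι : Type v} (e : G ≃* FreeGroup ι) {a b : ι} (hab : a ≠ b) :
    IsSlimGroup (profiniteCompletion G) :=
  haveI : IsFreeGroup G := IsFreeGroup.ofMulEquiv e.symm
  isSlimGroup_profiniteCompletion_of_isFreeGroup
    (exists_mul_ne_mul_of_mulEquiv e (FreeGroup.exists_mul_ne_mul_of_ne hab))

end Literature.GroupTheory

end
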